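import Literature.MathematicalPhysics.QuantumLattice.LinearMatrixODEProofs
import Literature.Computability.QuantumComplexity.SolovayKitaev.Basic
import Mathlib
import HarnessLib

/-!
# The ordered exponential of quantum belief propagation on finite matrices (stub B of line `gauge_qbp_far_seam`, part 1)

Helper module for route `TcThermcert1`, cruxes K1′ `ThermalStiffnessCeilingU8b8_le_7o44` (item `stmt-Ventures-24560`) and
K1 `ThermalStiffnessCeilingU8b10_le_1o8` (item `stmt-Ventures-26381`), line
`Cruxes/ThermalStiffnessCeilingU8b10_le_1o8/Lines/gauge_qbp_far_seam.lean` v1.3, registered stub B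
(`stub_farCutCurrent_of_clustering`: the fermionic, sector-compressed port of Capel–Moscolari–Teufel–Wessel (CMTW),
arXiv:2310.09182, Prop. 6 / Prop. 9 / Thm 14). This file is the MODEL-FREE LINEAR-ODE CORE of that port, on `Matrix n n ℂ`
with the `ℓ²`-operator norm, for an ARBITRARY continuous bounded coefficient `X : ℝ → Matrix n n ℂ` (in QBP,
`X(s) = -(β/2) Φ_β^{H(s)}(V)` with the quasi-local generator `Φ`; the generator itself, its weight `f_β` and its locality are the
subject of the sibling parts):

* §1 Grönwall bookkeeping: `gronwallBound 0 K ε x ≤ ε x e^{Kx}` (via `e^{y} - 1 ≤ y e^{y}`).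
* §2 The ordered exponential `η` (`η' = X(s) η`, `η(0) = 1`, which EXISTS on every `[0,T]` by the tree's
  `exists_linearODE_solution`): the norm bound `‖η(s)‖ ≤ e^{Ms}` (CMTW (10.4): `‖η(s)‖ ≤ e^{(β/2)s‖V‖}`), membership in any
  subalgebra containing all `X(s)` (strict locality of `η_ℓ`, CMTW §10.2.3), the inverse flow and `η ι = ι η = 1`.
* §3 **The conjugation identity** (CMTW Prop. 6, eq. (10.3): `e^{-βH(s)} = η(s) e^{-βH(0)} η(s)^*`): ANY family `E` solving the
  anticommutator-type equation `E' = X E + E Xᴴ` on `[0,T]` satisfies `E(s) = η(s) E(0) η(s)ᴴ` — proved by differentiating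
  `ι E ιᴴ` (zero derivative, `constant_of_has_deriv_right_zero`), no series and no time ordering.
* §4 **Stability** (the engine of CMTW Prop. 9 (iii), `‖η - η_ℓ‖ ≤ (β/2)s‖V‖e^{(β/2)s‖V‖} ζ`): two coefficients `X`, `Y` bounded
  by `M` and `δ`-close on `[0,T]` have ordered exponentials with `‖η(s) - θ(s)‖ ≤ δ s e^{2Ms}`.
* §5 The package for a Hermitian generator `Φ` and `X = -(β/2)Φ` (`Xᴴ = X`): existence of `η` with all four properties, ready
  to be fed the QBP derivative formula `d/ds e^{-βH(s)} = -(β/2){Φ(s), e^{-βH(s)}}` (sibling part).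
Theorems only (no definitions, no named facts); nothing about superconductivity in the Hubbard model is proved by anything
in this file.

References: Á. Capel, M. Moscolari, S. Teufel, T. Wessel, arXiv:2310.09182, §10.1.1 and §10.2.3 [CapelEtAl2023];
M. B. Hastings, Phys. Rev. B 76 (2007) 201102 (quantum belief propagation); the tree:
`exists_linearODE_solution`, `hasDerivWithinAt_conjTranspose` (LinearMatrixODEProofs), `SolovayKitaev.norm_one_le_one`
(`‖1‖ ≤ 1`); Mathlib
`norm_le_gronwallBound_of_norm_deriv_right_le`, `constant_of_has_deriv_right_zero`, `Submodule.projection`.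
-/

noncomputable section

open Set Filter Metric
open scoped Matrix Matrix.Norms.L2Operator Topology

namespace Summit.Ventures.CertifiedManyBodySolver.Theorems.TcThermcert1.GaugeQbpFarSeam

open Literature.MathematicalPhysics.QuantumLattice

/-! ## §1 Grönwall bookkeeping -/

/-- The Grönwall majorant started at `0`: `gronwallBound 0 K ε x ≤ ε x e^{Kx}` for `K, ε ≥ 0` (all real `x`). [folklore] -/
theorem gronwallBound_zero_le {K ε : ℝ} (hK : 0 ≤ K) (hε : 0 ≤ ε) (x : ℝ) :
    gronwallBound 0 K ε x ≤ ε * x * Real.exp (K * x) := by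
  by_cases hK0 : K = 0
  · subst hK0
    simp [gronwallBound_K0]
  · rw [gronwallBound_of_K_ne_0 hK0]
    simp only [zero_mul, zero_add]
    have hKpos : 0 < K := lt_of_le_of_ne hK (Ne.symm hK0)
    -- `e^{y} - 1 ≤ y e^{y}` (all real `y`; the tree's `AreaLaw.exp_sub_one_le_mul_exp`, re-derived to keep imports light)
    have key : Real.exp (K * x) - 1 ≤ K * x * Real.exp (K * x) := by
      have h1 : -(K * x) + 1 ≤ Real.exp (-(K * x)) := Real.add_one_le_exp _
      have h2 : Real.exp (-(K * x)) * Real.exp (K * x) = 1 := by rw [← Real.exp_add]; simp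
      have h3 := mul_le_mul_of_nonneg_right h1 (Real.exp_pos (K * x)).le
      nlinarith [Real.exp_pos (K * x)]
    rw [div_mul_eq_mul_div, div_le_iff₀ hKpos]
    have := mul_le_mul_of_nonneg_left key hε
    nlinarith [this]

section OrderedExponential

variable {n : Type*} [Fintype n] [DecidableEq n]

/-! ## §2 The ordered exponential: norm bound, subalgebra membership, inverse flow -/

/-- Interior points of `[0,T]`: the interval is a right-neighbourhood (for the one-sided constancy / Grönwall lemmas).
[folklore] -/
theorem Icc_mem_nhdsWithin_Ici_of_mem_Ico {T s : ℝ} (hs : s ∈ Ico 0 T) : Icc 0 T ∈ 𝓝[Ici s] s :=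
  mem_of_superset (Icc_mem_nhdsGE hs.2) (Icc_subset_Icc hs.1 le_rfl)

/-- A bound `‖X s‖ ≤ M` forces `0 ≤ M`. [folklore] -/
theorem nonneg_of_norm_le {X : ℝ → Matrix n n ℂ} {M : ℝ} (hXM : ∀ s, ‖X s‖ ≤ M) : 0 ≤ M :=
  (norm_nonneg _).trans (hXM 0)

/-- **Norm of the ordered exponential** (CMTW (10.4)): if `η(0) = 1` and `η' = X(s) η` on `[0,T]` with `‖X(s)‖ ≤ M`, then
`‖η(s)‖ ≤ e^{Ms}` on `[0,T]` (Grönwall). [cite: CapelEtAl2023, §10.1.1] -/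
theorem norm_orderedExp_le {X η : ℝ → Matrix n n ℂ} {M T : ℝ} (hXM : ∀ s, ‖X s‖ ≤ M)
    (hη0 : η 0 = 1) (hη : ∀ s ∈ Icc 0 T, HasDerivWithinAt η (X s * η s) (Icc 0 T) s) :
    ∀ s ∈ Icc 0 T, ‖η s‖ ≤ Real.exp (M * s) := by
  have hc : ContinuousOn η (Icc 0 T) := fun s hs => (hη s hs).continuousWithinAt
  have hd : ∀ s ∈ Ico 0 T, HasDerivWithinAt η (X s * η s) (Ici s) s := fun s hs =>
    (hη s ⟨hs.1, hs.2.le⟩).mono_of_mem_nhdsWithin (Icc_mem_nhdsWithin_Ici_of_mem_Ico hs)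
  have h1 : ‖η 0‖ ≤ 1 := by
    rw [hη0]
    exact Literature.Computability.QuantumComplexity.SolovayKitaev.norm_one_le_one
  have hb : ∀ s ∈ Ico 0 T, ‖X s * η s‖ ≤ M * ‖η s‖ + 0 := fun s _ => by
    rw [add_zero]
    exact (Matrix.l2_opNorm_mul _ _).trans (mul_le_mul_of_nonneg_right (hXM s) (norm_nonneg _))
  intro s hs
  have h := norm_le_gronwallBound_of_norm_deriv_right_le hc hd h1 hb s hs
  rwa [gronwallBound_ε0, sub_zero, one_mul] at h

/-- **The ordered exponential stays in any subalgebra containing the coefficients** (strict locality of the truncated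
`η_ℓ`, CMTW §10.2.3: `η_ℓ(s) ∈ 𝒜_{X_ℓ}`): if `S` is a subalgebra with `X(s) ∈ S` for all `s`, then `η(s) ∈ S` on `[0,T]`.
Proof: for a linear projection `Q` vanishing exactly on `S`, `q = Q ∘ η` solves the linear equation `q' = Q(X q)` with
`q(0) = Q(1) = 0`, hence vanishes by Grönwall. [cite: CapelEtAl2023, §10.2.3] -/
theorem orderedExp_mem_subalgebra (S : Subalgebra ℂ (Matrix n n ℂ)) {X η : ℝ → Matrix n n ℂ} {M T : ℝ}
    (hXM : ∀ s, ‖X s‖ ≤ M) (hXS : ∀ s, X s ∈ S) (hη0 : η 0 = 1)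
    (hη : ∀ s ∈ Icc 0 T, HasDerivWithinAt η (X s * η s) (Icc 0 T) s) :
    ∀ s ∈ Icc 0 T, η s ∈ S := by
  obtain ⟨W, hW⟩ := (Subalgebra.toSubmodule S).exists_isCompl
  -- `P` = projection onto `S` along `W`, `Q` = projection onto `W` along `S`
  set P : Matrix n n ℂ →ₗ[ℂ] Matrix n n ℂ := (Subalgebra.toSubmodule S).projection W hW with hP
  set Q : Matrix n n ℂ →ₗ[ℂ] Matrix n n ℂ := W.projection (Subalgebra.toSubmodule S) hW.symm with hQ
  have hQzero : ∀ x : Matrix n n ℂ, Q x = 0 ↔ x ∈ S := fun x => by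
    rw [hQ, Submodule.projection_apply_eq_zero_iff]
    rfl
  have hPmem : ∀ x : Matrix n n ℂ, P x ∈ S := fun x => by
    rw [hP]
    exact Submodule.projection_apply_mem hW x
  have hPQ : ∀ x : Matrix n n ℂ, P x + Q x = x := fun x => Submodule.projection_add_projection_eq_self hW x
  -- continuity of `Q` (finite dimension) and its operator norm
  let Qc : Matrix n n ℂ →L[ℂ] Matrix n n ℂ := ⟨Q, LinearMap.continuous_of_finiteDimensional Q⟩
  have hQc : ∀ x, Qc x = Q x := fun _ => rfl
  -- the reduced equation for `q = Q ∘ η`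
  have hq : ∀ s ∈ Icc 0 T,
      HasDerivWithinAt (fun u => Qc (η u)) (Qc (X s * Qc (η s))) (Icc 0 T) s := by
    intro s hs
    have h := (Qc.restrictScalars ℝ).hasFDerivAt.comp_hasDerivWithinAt s (hη s hs)
    have h' : HasDerivWithinAt (fun u => Qc (η u)) (Qc (X s * η s)) (Icc 0 T) s := h
    refine h'.congr_deriv ?_
    -- `Q (X η) = Q (X (P η)) + Q (X (Q η))` and `X (P η) ∈ S`
    have hsplit : X s * η s = X s * P (η s) + X s * Q (η s) := by
      rw [← Matrix.mul_add, hPQ]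
    have hXP : Qc (X s * P (η s)) = 0 := by
      rw [hQc, hQzero]
      exact S.mul_mem (hXS s) (hPmem _)
    rw [hsplit, map_add, hXP, zero_add]
    rfl
  have hc : ContinuousOn (fun u => Qc (η u)) (Icc 0 T) := fun s hs => (hq s hs).continuousWithinAt
  have hd : ∀ s ∈ Ico 0 T, HasDerivWithinAt (fun u => Qc (η u)) (Qc (X s * Qc (η s))) (Ici s) s :=
    fun s hs => (hq s ⟨hs.1, hs.2.le⟩).mono_of_mem_nhdsWithin (Icc_mem_nhdsWithin_Ici_of_mem_Ico hs)
  have h0 : ‖Qc (η 0)‖ ≤ 0 := by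
    rw [hη0, hQc, (hQzero 1).2 S.one_mem, norm_zero]
  have hb : ∀ s ∈ Ico 0 T, ‖Qc (X s * Qc (η s))‖ ≤ ‖Qc‖ * M * ‖Qc (η s)‖ + 0 := by
    intro s _
    rw [add_zero]
    calc ‖Qc (X s * Qc (η s))‖ ≤ ‖Qc‖ * ‖X s * Qc (η s)‖ := Qc.le_opNorm _
      _ ≤ ‖Qc‖ * (M * ‖Qc (η s)‖) := by
          refine mul_le_mul_of_nonneg_left ?_ (norm_nonneg Qc)
          exact (Matrix.l2_opNorm_mul _ _).trans (mul_le_mul_of_nonneg_right (hXM s) (norm_nonneg _))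
      _ = ‖Qc‖ * M * ‖Qc (η s)‖ := by ring
  intro s hs
  have h := norm_le_gronwallBound_of_norm_deriv_right_le hc hd h0 hb s hs
  rw [gronwallBound_ε0_δ0] at h
  have hQη : Q (η s) = 0 := by
    rw [← hQc]
    exact norm_le_zero_iff.1 h
  rw [← hPQ (η s), hQη, add_zero]
  exact hPmem _

/-- **The inverse flow.** For a continuous bounded coefficient there is `ι` with `ι(0) = 1` and `ι' = -ι X(s)` on `[0,T]`
(the conjugate transpose of the solution of `W' = -X(s)ᴴ W`). [folklore] -/
theorem exists_inverseFlow {X : ℝ → Matrix n n ℂ} (hXc : Continuous X) {M : ℝ} (hXM : ∀ s, ‖X s‖ ≤ M) (T : ℝ) :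
    ∃ ι : ℝ → Matrix n n ℂ, ι 0 = 1 ∧
      ∀ s ∈ Icc 0 T, HasDerivWithinAt ι (-(ι s * X s)) (Icc 0 T) s := by
  have hAc : Continuous fun s => -(X s)ᴴ := hXc.matrix_conjTranspose.neg
  have hAM : ∀ s, ‖-(X s)ᴴ‖ ≤ M := fun s => by
    rw [norm_neg, Matrix.l2_opNorm_conjTranspose]
    exact hXM s
  obtain ⟨W, hW0, hW⟩ := exists_linearODE_solution hAc hAM T
  refine ⟨fun s => (W s)ᴴ, by simp [hW0], fun s hs => ?_⟩
  have h := hasDerivWithinAt_conjTranspose (hW s hs)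
  refine h.congr_deriv ?_
  simp only [Matrix.conjTranspose_mul, Matrix.conjTranspose_neg, Matrix.conjTranspose_conjTranspose, Matrix.mul_neg]

/-- **`ι η = 1`**: the inverse flow is a left inverse of the ordered exponential (`(ι η)' = -ιXη + ιXη = 0`). [folklore] -/
theorem inverseFlow_mul_orderedExp {X η ι : ℝ → Matrix n n ℂ} {T : ℝ}
    (hη0 : η 0 = 1) (hη : ∀ s ∈ Icc 0 T, HasDerivWithinAt η (X s * η s) (Icc 0 T) s)
    (hι0 : ι 0 = 1) (hι : ∀ s ∈ Icc 0 T, HasDerivWithinAt ι (-(ι s * X s)) (Icc 0 T) s) :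
    ∀ s ∈ Icc 0 T, ι s * η s = 1 := by
  have hd : ∀ s ∈ Icc 0 T, HasDerivWithinAt (fun u => ι u * η u) 0 (Icc 0 T) s := by
    intro s hs
    have h := (hι s hs).mul (hη s hs)
    refine h.congr_deriv ?_
    noncomm_ring
  have hc : ContinuousOn (fun u => ι u * η u) (Icc 0 T) := fun s hs => (hd s hs).continuousWithinAt
  intro s hs
  have h := constant_of_has_deriv_right_zero hc
    (fun x hx => (hd x ⟨hx.1, hx.2.le⟩).mono_of_mem_nhdsWithin (Icc_mem_nhdsWithin_Ici_of_mem_Ico hx)) s hs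
  rw [h, hι0, hη0, Matrix.mul_one]

/-- **`η ι = 1`** as well (square matrices). [folklore] -/
theorem orderedExp_mul_inverseFlow {X η ι : ℝ → Matrix n n ℂ} {T : ℝ}
    (hη0 : η 0 = 1) (hη : ∀ s ∈ Icc 0 T, HasDerivWithinAt η (X s * η s) (Icc 0 T) s)
    (hι0 : ι 0 = 1) (hι : ∀ s ∈ Icc 0 T, HasDerivWithinAt ι (-(ι s * X s)) (Icc 0 T) s) :
    ∀ s ∈ Icc 0 T, η s * ι s = 1 := fun s hs =>
  mul_eq_one_comm.mp (inverseFlow_mul_orderedExp hη0 hη hι0 hι s hs)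

/-! ## §3 The conjugation identity `E(s) = η(s) E(0) η(s)ᴴ` -/

/-- **Conjugation identity of quantum belief propagation** (CMTW Prop. 6, eq. (10.3) `e^{-βH(s)} = η(s) e^{-βH(0)} η(s)^*`,
in abstract form): if `η(0) = 1`, `η' = X(s) η`, and `E` solves `E' = X(s) E + E X(s)ᴴ` on `[0,T]` (for QBP:
`E(s) = e^{-βH(s)}`, `X(s) = -(β/2)Φ_β^{H(s)}(V)` Hermitian), then `E(s) = η(s) E(0) η(s)ᴴ` on `[0,T]`. Proof: with the
inverse flow `ι` (`ι' = -ιX`, `ιη = ηι = 1`) the family `ι E ιᴴ` has zero derivative.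
[cite: CapelEtAl2023, Proposition 6] -/
theorem eq_orderedExp_mul_mul_conjTranspose {X η E : ℝ → Matrix n n ℂ} {M T : ℝ} (hXc : Continuous X)
    (hXM : ∀ s, ‖X s‖ ≤ M) (hη0 : η 0 = 1) (hη : ∀ s ∈ Icc 0 T, HasDerivWithinAt η (X s * η s) (Icc 0 T) s)
    (hE : ∀ s ∈ Icc 0 T, HasDerivWithinAt E (X s * E s + E s * (X s)ᴴ) (Icc 0 T) s) :
    ∀ s ∈ Icc 0 T, E s = η s * E 0 * (η s)ᴴ := by
  obtain ⟨ι, hι0, hι⟩ := exists_inverseFlow hXc hXM T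
  have hιη := inverseFlow_mul_orderedExp hη0 hη hι0 hι
  have hηι := orderedExp_mul_inverseFlow hη0 hη hι0 hι
  -- `R = ι E ιᴴ` is constant
  have hd : ∀ s ∈ Icc 0 T, HasDerivWithinAt (fun u => ι u * E u * (ι u)ᴴ) 0 (Icc 0 T) s := by
    intro s hs
    have h := ((hι s hs).mul (hE s hs)).mul (hasDerivWithinAt_conjTranspose (hι s hs))
    refine h.congr_deriv ?_
    simp only [Pi.mul_apply, Matrix.conjTranspose_neg, Matrix.conjTranspose_mul]
    noncomm_ring
  have hc : ContinuousOn (fun u => ι u * E u * (ι u)ᴴ) (Icc 0 T) := fun s hs => (hd s hs).continuousWithinAt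
  intro s hs
  have hR := constant_of_has_deriv_right_zero hc
    (fun x hx => (hd x ⟨hx.1, hx.2.le⟩).mono_of_mem_nhdsWithin (Icc_mem_nhdsWithin_Ici_of_mem_Ico hx)) s hs
  simp only [hι0, Matrix.conjTranspose_one, Matrix.one_mul, Matrix.mul_one] at hR
  -- `E s = η (ι E ιᴴ) ηᴴ`
  have h1 : (ι s)ᴴ * (η s)ᴴ = 1 := by
    rw [← Matrix.conjTranspose_mul, hηι s hs, Matrix.conjTranspose_one]
  calc E s = (η s * ι s) * E s * ((ι s)ᴴ * (η s)ᴴ) := by rw [hηι s hs, h1, Matrix.one_mul, Matrix.mul_one]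
    _ = η s * (ι s * E s * (ι s)ᴴ) * (η s)ᴴ := by noncomm_ring
    _ = η s * E 0 * (η s)ᴴ := by rw [hR]

/-! ## §4 Stability of the ordered exponential in the coefficient -/

/-- Restriction of the defining equation to an initial segment `[0,T'] ⊆ [0,T]`. [folklore] -/
theorem hasDerivWithinAt_restrict {η : ℝ → Matrix n n ℂ} {D : ℝ → Matrix n n ℂ} {T T' : ℝ} (hT' : T' ≤ T)
    (hη : ∀ s ∈ Icc 0 T, HasDerivWithinAt η (D s) (Icc 0 T) s) :
    ∀ s ∈ Icc 0 T', HasDerivWithinAt η (D s) (Icc 0 T') s := fun s hs =>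
  (hη s ⟨hs.1, hs.2.trans hT'⟩).mono (Icc_subset_Icc le_rfl hT')

/-- Stability at the right endpoint: two coefficients bounded by `M` and `δ`-close on `[0,T]` (`0 ≤ T`) give
`‖η(T) - θ(T)‖ ≤ δ T e^{2MT}`. [cite: CapelEtAl2023, §10.2.3] -/
theorem norm_orderedExp_sub_le_endpoint {X Y η θ : ℝ → Matrix n n ℂ} {M δ T : ℝ} (hT : 0 ≤ T)
    (hXM : ∀ s, ‖X s‖ ≤ M) (hYM : ∀ s, ‖Y s‖ ≤ M) (hXY : ∀ s ∈ Icc 0 T, ‖X s - Y s‖ ≤ δ)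
    (hη0 : η 0 = 1) (hη : ∀ s ∈ Icc 0 T, HasDerivWithinAt η (X s * η s) (Icc 0 T) s)
    (hθ0 : θ 0 = 1) (hθ : ∀ s ∈ Icc 0 T, HasDerivWithinAt θ (Y s * θ s) (Icc 0 T) s) :
    ‖η T - θ T‖ ≤ δ * T * Real.exp (2 * M * T) := by
  have hM : 0 ≤ M := nonneg_of_norm_le hXM
  have hδ : 0 ≤ δ := (norm_nonneg _).trans (hXY 0 ⟨le_rfl, hT⟩)
  have hθn := norm_orderedExp_le hYM hθ0 hθ
  -- the difference `d = η - θ` solves `d' = X d + (X - Y) θ`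
  have hd : ∀ s ∈ Icc 0 T, HasDerivWithinAt (fun u => η u - θ u)
      (X s * (η s - θ s) + (X s - Y s) * θ s) (Icc 0 T) s := by
    intro s hs
    refine ((hη s hs).sub (hθ s hs)).congr_deriv ?_
    noncomm_ring
  have hc : ContinuousOn (fun u => η u - θ u) (Icc 0 T) := fun s hs => (hd s hs).continuousWithinAt
  have hd' : ∀ s ∈ Ico 0 T, HasDerivWithinAt (fun u => η u - θ u)
      (X s * (η s - θ s) + (X s - Y s) * θ s) (Ici s) s :=
    fun s hs => (hd s ⟨hs.1, hs.2.le⟩).mono_of_mem_nhdsWithin (Icc_mem_nhdsWithin_Ici_of_mem_Ico hs)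
  have h0 : ‖η 0 - θ 0‖ ≤ 0 := by rw [hη0, hθ0, sub_self, norm_zero]
  have hb : ∀ s ∈ Ico 0 T, ‖X s * (η s - θ s) + (X s - Y s) * θ s‖ ≤
      M * ‖η s - θ s‖ + δ * Real.exp (M * T) := by
    intro s hs
    have hs' : s ∈ Icc 0 T := ⟨hs.1, hs.2.le⟩
    calc ‖X s * (η s - θ s) + (X s - Y s) * θ s‖
        ≤ ‖X s * (η s - θ s)‖ + ‖(X s - Y s) * θ s‖ := norm_add_le _ _
      _ ≤ ‖X s‖ * ‖η s - θ s‖ + ‖X s - Y s‖ * ‖θ s‖ :=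
          add_le_add (Matrix.l2_opNorm_mul _ _) (Matrix.l2_opNorm_mul _ _)
      _ ≤ M * ‖η s - θ s‖ + δ * Real.exp (M * T) := by
          refine add_le_add (mul_le_mul_of_nonneg_right (hXM s) (norm_nonneg _)) ?_
          refine mul_le_mul (hXY s hs') ((hθn s hs').trans ?_) (norm_nonneg _) hδ
          exact Real.exp_le_exp.2 (mul_le_mul_of_nonneg_left hs.2.le hM)
  have h := norm_le_gronwallBound_of_norm_deriv_right_le hc hd' h0 hb T ⟨hT, le_rfl⟩
  rw [sub_zero] at h
  refine h.trans ((gronwallBound_zero_le hM (by positivity) T).trans (le_of_eq ?_))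
  rw [show 2 * M * T = M * T + M * T by ring, Real.exp_add]
  ring

/-- **Stability of the ordered exponential in the coefficient** (the engine of CMTW Prop. 9 (iii),
`‖η(s) - η_ℓ(s)‖ ≤ (β/2) s ‖V‖ e^{(β/2)s‖V‖} ζ_QBP(X,ℓ)`): if `X`, `Y` are bounded by `M` and `‖X(s) - Y(s)‖ ≤ δ` on `[0,T]`,
their ordered exponentials satisfy `‖η(s) - θ(s)‖ ≤ δ s e^{2Ms}` for all `s ∈ [0,T]`.
[cite: CapelEtAl2023, Proposition 9] -/
theorem norm_orderedExp_sub_le {X Y η θ : ℝ → Matrix n n ℂ} {M δ T : ℝ}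
    (hXM : ∀ s, ‖X s‖ ≤ M) (hYM : ∀ s, ‖Y s‖ ≤ M) (hXY : ∀ s ∈ Icc 0 T, ‖X s - Y s‖ ≤ δ)
    (hη0 : η 0 = 1) (hη : ∀ s ∈ Icc 0 T, HasDerivWithinAt η (X s * η s) (Icc 0 T) s)
    (hθ0 : θ 0 = 1) (hθ : ∀ s ∈ Icc 0 T, HasDerivWithinAt θ (Y s * θ s) (Icc 0 T) s) :
    ∀ s ∈ Icc 0 T, ‖η s - θ s‖ ≤ δ * s * Real.exp (2 * M * s) := fun _ hs =>
  norm_orderedExp_sub_le_endpoint hs.1 hXM hYM (fun u hu => hXY u ⟨hu.1, hu.2.trans hs.2⟩) hη0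
    (hasDerivWithinAt_restrict hs.2 hη) hθ0 (hasDerivWithinAt_restrict hs.2 hθ)

/-! ## §5 The package for a Hermitian generator: `X = -(β/2) Φ` -/

omit [Fintype n] [DecidableEq n] in
/-- `(-(β/2) Φ)ᴴ = -(β/2) Φ` for Hermitian `Φ` and real `β`. [folklore] -/
theorem conjTranspose_qbpCoeff {Φ : Matrix n n ℂ} (hΦ : Φ.IsHermitian) (β : ℝ) :
    (-(((β / 2 : ℝ) : ℂ) • Φ))ᴴ = -(((β / 2 : ℝ) : ℂ) • Φ) := by
  rw [Matrix.conjTranspose_neg, Matrix.conjTranspose_smul, hΦ.eq, Complex.star_def, Complex.conj_ofReal]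

/-- Norm of the QBP coefficient: `‖-(β/2)Φ‖ ≤ (β/2) M` when `‖Φ‖ ≤ M` and `0 ≤ β`. [folklore] -/
theorem norm_qbpCoeff_le {Φ : Matrix n n ℂ} {M β : ℝ} (hΦ : ‖Φ‖ ≤ M) (hβ : 0 ≤ β) :
    ‖-(((β / 2 : ℝ) : ℂ) • Φ)‖ ≤ β / 2 * M := by
  rw [norm_neg, norm_smul, Complex.norm_real, Real.norm_eq_abs, abs_of_nonneg (by positivity)]
  exact mul_le_mul_of_nonneg_left hΦ (by positivity)

/-- **The ordered exponential of quantum belief propagation, generic generator** (CMTW Prop. 6 with Prop. 9 (iii) and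
§10.2.3, model-free form). Let `Φ : ℝ → Matrix n n ℂ` be continuous, bounded by `M`, pointwise Hermitian, `0 ≤ β`, and let
`E` solve the QBP equation `E' = -(β/2)(Φ(s) E + E Φ(s))` on `[0,T]` (for `E(s) = e^{-βH(s)}`, `H(s) = H + sV`, this is
`d/ds e^{-βH(s)} = -(β/2){Φ_β^{H(s)}(V), e^{-βH(s)}}`, CMTW (10.1)). Then there is `η` with `η(0) = 1`,
`η' = -(β/2)Φ(s) η`, `‖η(s)‖ ≤ e^{(β/2)Ms}`, **`E(s) = η(s) E(0) η(s)ᴴ`**, and `η(s) ∈ S` for every subalgebra `S`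
containing all `Φ(s)`. (Stability under `Φ ↦ Φ'`: `norm_orderedExp_sub_le`.)
[cite: CapelEtAl2023, Proposition 6] -/
theorem exists_qbp_orderedExp {Φ E : ℝ → Matrix n n ℂ} {β M T : ℝ} (hΦc : Continuous Φ)
    (hΦM : ∀ s, ‖Φ s‖ ≤ M) (hΦh : ∀ s, (Φ s).IsHermitian) (hβ : 0 ≤ β)
    (hE : ∀ s ∈ Icc 0 T, HasDerivWithinAt E
      (-(((β / 2 : ℝ) : ℂ) • (Φ s * E s + E s * Φ s))) (Icc 0 T) s) :
    ∃ η : ℝ → Matrix n n ℂ, η 0 = 1 ∧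
      (∀ s ∈ Icc 0 T, HasDerivWithinAt η (-(((β / 2 : ℝ) : ℂ) • Φ s) * η s) (Icc 0 T) s) ∧
      (∀ s ∈ Icc 0 T, ‖η s‖ ≤ Real.exp (β / 2 * M * s)) ∧
      (∀ s ∈ Icc 0 T, E s = η s * E 0 * (η s)ᴴ) ∧
      (∀ S : Subalgebra ℂ (Matrix n n ℂ), (∀ s, Φ s ∈ S) → ∀ s ∈ Icc 0 T, η s ∈ S) := by
  set X : ℝ → Matrix n n ℂ := fun s => -(((β / 2 : ℝ) : ℂ) • Φ s) with hX
  have hXc : Continuous X := by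
    rw [hX]
    exact (hΦc.const_smul (((β / 2 : ℝ) : ℂ))).neg
  have hXM : ∀ s, ‖X s‖ ≤ β / 2 * M := fun s => norm_qbpCoeff_le (hΦM s) hβ
  obtain ⟨η, hη0, hη⟩ := exists_linearODE_solution hXc hXM T
  have hXh : ∀ s, (X s)ᴴ = X s := fun s => conjTranspose_qbpCoeff (hΦh s) β
  have hE' : ∀ s ∈ Icc 0 T, HasDerivWithinAt E (X s * E s + E s * (X s)ᴴ) (Icc 0 T) s := by
    intro s hs
    refine (hE s hs).congr_deriv ?_
    rw [hXh s, hX]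
    simp only [Matrix.neg_mul, Matrix.mul_neg, Matrix.smul_mul, Matrix.mul_smul, smul_add, neg_add]
  refine ⟨η, hη0, hη, norm_orderedExp_le hXM hη0 hη, eq_orderedExp_mul_mul_conjTranspose hXc hXM hη0 hη hE', ?_⟩
  intro S hS
  exact orderedExp_mem_subalgebra S hXM (fun s => S.neg_mem (S.smul_mem (hS s) _)) hη0 hη

end OrderedExponential

end Summit.Ventures.CertifiedManyBodySolver.Theorems.TcThermcert1.GaugeQbpFarSeam
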